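import Summits.QuantumFields.YangMills.Theorems.BalabanUVNodesN15CovariantAveragingLetterLocal
import HarnessLib

/-!
# N15 = NE2, road (c) — PROGRAMME (PC), towards (PC-E): THE FINE-GRID TWIN OF n15-c∕317 §3 — the fine averaging perturbation `N_V^Q′(U′)∘M_{χ′}` reads `U′` only on the unit blocks one step
# around `supp χ′`; hence n15-c∕`cv_hasMaj_sandwich_cvNVq'` holds with BOX-LOCAL transporter letters (dag-n15-c g30, n15-c∕324)

Cell `pub-ymgap`, seat `pub-ymgap-dag-n15-c` (generation g30; R134 (a), s1; HUMAN RULING D-0062).  `bears_on: R4∕N15 · K3⁸ SpineGivenEndpointR13SepCoPHV (stmt-QuantumFields-27366)`;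
filed `--kind proof --supports stmt-QuantumFields-27366 --as helper` — COUNT-NEUTRAL.  Two theorems, 0 `def`, 0 `sorry`; the text of n15-c∕317 §3 VERBATIM with the fine spacing
`L^rL^k` in place of `L^k` (n15-c∕317 §1–§2 are generic in the spacing and are used BY NAME: `CovAvg.qvCovAdj_comp_qvCov_comp_mulOp_congr`).  Imports BY NAME n15-c∕317 (through it
n15-c∕`cv_hasMaj_sandwich_cvNVq'`, `cvNVq'`, `CvX'`, `kingPrV`).  Nothing in the tree is modified.

WHY.  The two-grid η-defect knit (n15-c∕123 ∕ 127 `uN_idef_cvGlued_of_reg335Box`) displays the near∕far rows of the perturbation on BOTH grids (`hNVcut′`∕`hfarN′` in the fine norm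
`cvBlk∘π̂`).  For the per-cube class the coarse `Q`-part rows are n15-c∕317∕318; THIS FILE is the fine-grid half of n15-c∕317 — the first brick of (PC-E) that does not depend on the
pairing decision (HOME HANDOFF §g30).

WHAT.  `cvNVq'_comp_mulOp_congr`, ★★★ `cv_hasMaj_sandwich_cvNVq'_local` — for cuts `|f′|, |χ′| ≤ 1` on the fine carrier with `B′(supp χ′) ⊆ S` (`B′ = B∘π̂`, unit blocks) and
`S ∪ (S ± e_κ) ⊆ S′` stepwise: IF `rows∕cols(cvT e U′ − 1) ≤ ρ` at the fine bond points whose unit block lies in `S′`, THEN `M_{f′}∘N_V^Q′(U′)∘M_{χ′} ≤ |a|K₁(2+K₁)·c_δe^{3δ}·e^{−δd}` in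
FILE 123's fine norm, `K₁ = (1+ρ)^{(d+2)L^rL^k} − 1`.

HONEST FRAMING ∕ LIMITS.  Bookkeeping on MODEL carriers (as n15-c∕317); [B9] (3.26) p.395, (3.59)–(3.60) p.402, Cor. 3.8 p.410 cited for SHAPES ∕ MECHANISM only.  NE2⁺ NOT PRINTED, NOT
proved; N15 of record untouched (DISCHARGED AS CONSUMED, p687738); K3⁸ OPEN; counts UNMOVED (typed 28∕28); one finite 𝕋⁴ at fixed ε per index — NOT infinite volume, NOT OS on ℝ⁴, NOT a
mass gap, NOT Clay.  Restate-immune (no Theses import).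
-/

noncomputable section

open scoped BigOperators Matrix

/-! ## The row of `N_V^Q′` (FINE grid) behind a cut from BOX-LOCAL transporter letters -/

namespace Summit.QuantumFields.YangMills.BalabanUVNodes.N15.Gluing

open Real
open Literature.MathematicalPhysics.QuantumFieldTheory.Balaban1983to89
open Literature.MathematicalPhysics.QuantumFieldTheory.Balaban1983to89.B11SectG (BlockNorm HasMaj)
open Literature.MathematicalPhysics.QuantumFieldTheory.Balaban1983to89.B6Prop26Gluing (mulOp mulOp_apply)
open Literature.MathematicalPhysics.QuantumFieldTheory.Balaban1983to89.B6UnitTorusCarrier (unitTorusGeo)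
open Literature.MathematicalPhysics.QuantumFieldTheory.Balaban1983to89.B5Prop11Plancherel (Tor fine unitVec)
open Literature.MathematicalPhysics.QuantumFieldTheory.King1986.Torus (blockOf)
open Summit.QuantumFields.YangMills.BalabanUVNodes.N15.VectorPiece (tensorId)
open Summit.QuantumFields.YangMills.BalabanUVNodes.N15.TwoGrid (qvRe qvAdjRe)
open Summit.QuantumFields.YangMills.BalabanUVNodes.N15.CovAvg (qvCov qvCovAdj qvCovAdj_comp_qvCov_comp_mulOp_congr)
open Summit.QuantumFields.YangMills.BalabanUVNodes.N15.VectorPiece (kingPrV)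
open Summit.QuantumFields.YangMills.BalabanUVNodes.N15.MatrixSpecies (liftBlk)

variable {d : ℕ}

section Local

open scoped Matrix.Norms.L2Operator

variable {L : ℕ} [NeZero L] {mm : Type} [Fintype mm] [DecidableEq mm] {ι : Type} [Fintype ι] [DecidableEq ι] (e : Matrix mm mm ℂ ≃L[ℝ] (ι → ℝ))
variable (mv kk r : ℕ) (hL : Odd L ∧ 1 < L) (a : ℝ)

/-- FINE GRID: `N_V^Q′(U′)∘M_χ′ = N_V^Q′(U″)∘M_χ′` when `U′ = U″` at the fine bond points whose (unit) block lies in `S′` (`S ∪ (S ± e_κ) ⊆ S′` stepwise, `S ⊇ B(supp χ)`).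
[cite: Balaban1985BackgroundPropagators, (3.59)–(3.60) p.402, Cor. 3.8 p.410 (locality in U: mechanism)] -/
theorem cvNVq'_comp_mulOp_congr {U U' : Fin (d + 1) → CvX' d L mv kk r hL → Matrix mm mm ℂ} {χ : CvX' d L mv kk r hL → ℝ} {S S' : Finset (Tor (cvM d L mv kk hL))}
    (hχS : ∀ p, χ p ≠ 0 → blockOf (L ^ r * L ^ kk) (cvM d L mv kk hL) p.1 ∈ S)
    (hS' : ∀ y κ, (y ∈ S ∨ y + unitVec (cvM d L mv kk hL) κ ∈ S) → y ∈ S' ∧ y + unitVec (cvM d L mv kk hL) κ ∈ S')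
    (hUU' : ∀ μ (p : CvX' d L mv kk r hL), blockOf (L ^ r * L ^ kk) (cvM d L mv kk hL) p.1 ∈ S' → U μ p = U' μ p) :
    cvNVq' d L mv kk r hL a ι e U ∘ₗ mulOp (fun q : CvX' d L mv kk r hL × ι => χ q.1) = cvNVq' d L mv kk r hL a ι e U' ∘ₗ mulOp (fun q : CvX' d L mv kk r hL × ι => χ q.1) := by
  have hT : ∀ μ (p : CvX' d L mv kk r hL), blockOf (L ^ r * L ^ kk) (cvM d L mv kk hL) p.1 ∈ S' → cvT e U μ p = cvT e U' μ p := fun μ p hp => by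
    simp only [cvT, hUU' μ p hp]
  rw [cvNVq', cvNVq', LinearMap.smul_comp, LinearMap.smul_comp, LinearMap.sub_comp, LinearMap.sub_comp,
    qvCovAdj_comp_qvCov_comp_mulOp_congr (cvM d L mv kk hL) (L ^ r * L ^ kk) hχS hS' hT]

/-- ★★★ **FINE GRID: THE ROW OF `N_V^Q′` BEHIND A CUT FROM BOX-LOCAL TRANSPORTER LETTERS** (n15-c∕`cv_hasMaj_sandwich_cvNVq'` localised, FILE 123's fine norm `cvBlk∘π̂`): for cuts `|f|, |χ| ≤ 1` with `B(supp χ) ⊆ S` and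
`S ∪ (S ± e_κ) ⊆ S′` stepwise, IF `rows∕cols(coordMat e Ad_{U_μ(p)} − 1) ≤ ρ` at the bond points `p` with `B(p) ∈ S′` (nothing asked elsewhere), THEN
`M_{f′}∘N_V^Q′(U′)∘M_{χ′} ≤ |a|K₁(2+K₁)·c_δe^{3δ}·e^{−δd}`, `K₁ = (1+ρ)^{(d+2)L^rL^k} − 1` (the global lemma at the field extended by `𝟙` off `S′`).
[cite: Balaban1985BackgroundPropagators, (3.26) p.395, (3.35) p.396, (3.59)–(3.60) p.402, Cor. 3.8 p.410 (mechanism)] -/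
theorem cv_hasMaj_sandwich_cvNVq'_local {U : Fin (d + 1) → CvX' d L mv kk r hL → Matrix mm mm ℂ} {ρ δ : ℝ} (hρ : 0 ≤ ρ) (hδ : 0 < δ)
    {S S' : Finset (Tor (cvM d L mv kk hL))} (hS' : ∀ y κ, (y ∈ S ∨ y + unitVec (cvM d L mv kk hL) κ ∈ S) → y ∈ S' ∧ y + unitVec (cvM d L mv kk hL) κ ∈ S')
    (hTr : ∀ μ (p : CvX' d L mv kk r hL), blockOf (L ^ r * L ^ kk) (cvM d L mv kk hL) p.1 ∈ S' → ∀ i, ∑ j, |(cvT e U μ p - 1) i j| ≤ ρ)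
    (hTc : ∀ μ (p : CvX' d L mv kk r hL), blockOf (L ^ r * L ^ kk) (cvM d L mv kk hL) p.1 ∈ S' → ∀ j, ∑ i, |(cvT e U μ p - 1) i j| ≤ ρ)
    (f χ : CvX' d L mv kk r hL → ℝ) (hf : ∀ x, |f x| ≤ 1) (hχ : ∀ x, |χ x| ≤ 1) (hχS : ∀ p, χ p ≠ 0 → blockOf (L ^ r * L ^ kk) (cvM d L mv kk hL) p.1 ∈ S) :
    HasMaj (BlockNorm.ofBlocks (unitTorusGeo L kk (cvM d L mv kk hL)) (liftBlk (cvBlk d L mv kk hL ∘ kingPrV L kk r (cvM d L mv kk hL)) ι))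
      (BlockNorm.ofBlocks (unitTorusGeo L kk (cvM d L mv kk hL)) (liftBlk (cvBlk d L mv kk hL ∘ kingPrV L kk r (cvM d L mv kk hL)) ι))
      (mulOp (fun p : CvX' d L mv kk r hL × ι => f p.1) ∘ₗ cvNVq' d L mv kk r hL a ι e U ∘ₗ mulOp (fun p : CvX' d L mv kk r hL × ι => χ p.1))
      (fun y y' => |a| * (((1 + ρ) ^ ((d + 2) * (L ^ r * L ^ kk)) - 1) * (2 + ((1 + ρ) ^ ((d + 2) * (L ^ r * L ^ kk)) - 1)) * (B4Sect5Proof.latticeConst (d + 1) δ * Real.exp (3 * δ))) *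
        Real.exp (-(δ * (unitTorusGeo L kk (cvM d L mv kk hL)).dist y y'))) := by
  classical
  -- the field EXTENDED BY `𝟙` off `S′` is globally `ρ`-close to `1`
  let U' : Fin (d + 1) → CvX' d L mv kk r hL → Matrix mm mm ℂ := fun μ p => if blockOf (L ^ r * L ^ kk) (cvM d L mv kk hL) p.1 ∈ S' then U μ p else 1
  have hUU' : ∀ μ (p : CvX' d L mv kk r hL), blockOf (L ^ r * L ^ kk) (cvM d L mv kk hL) p.1 ∈ S' → U μ p = U' μ p := fun μ p hp => by
    simp only [U', if_pos hp]
  have hT' : ∀ μ (p : CvX' d L mv kk r hL), blockOf (L ^ r * L ^ kk) (cvM d L mv kk hL) p.1 ∉ S' → cvT e U' μ p = 1 := fun μ p hp => by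
    simp only [cvT, U', if_neg hp]
    exact CurvedSpecies.coordMat_conj_one e
  have hTr' : ∀ μ (p : CvX' d L mv kk r hL) i, ∑ j, |(cvT e U' μ p - 1) i j| ≤ ρ := fun μ p i => by
    by_cases hp : blockOf (L ^ r * L ^ kk) (cvM d L mv kk hL) p.1 ∈ S'
    · have e1 : cvT e U' μ p = cvT e U μ p := by simp only [cvT, U', if_pos hp]
      rw [e1]; exact hTr μ p hp i
    · rw [hT' μ p hp, sub_self]
      simp only [Matrix.zero_apply, abs_zero, Finset.sum_const_zero]
      exact hρ
  have hTc' : ∀ μ (p : CvX' d L mv kk r hL) j, ∑ i, |(cvT e U' μ p - 1) i j| ≤ ρ := fun μ p j => by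
    by_cases hp : blockOf (L ^ r * L ^ kk) (cvM d L mv kk hL) p.1 ∈ S'
    · have e1 : cvT e U' μ p = cvT e U μ p := by simp only [cvT, U', if_pos hp]
      rw [e1]; exact hTc μ p hp j
    · rw [hT' μ p hp, sub_self]
      simp only [Matrix.zero_apply, abs_zero, Finset.sum_const_zero]
      exact hρ
  rw [cvNVq'_comp_mulOp_congr e mv kk r hL a hχS hS' hUU']
  exact cv_hasMaj_sandwich_cvNVq' e mv kk r hL a hρ hδ hTr' hTc' f χ hf hχ

end Local

end Summit.QuantumFields.YangMills.BalabanUVNodes.N15.Gluing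

end
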